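import Literature.AlgebraicGeometry.Resolution.PointBlowupHilbertSamuelStrata
import Literature.AlgebraicGeometry.Resolution.PointBlowupHsFunMono
import Literature.AlgebraicGeometry.Resolution.CohenMacaulayCatenary
import Literature.AlgebraicGeometry.Resolution.ExcellentRingsEssFiniteType
import Literature.AlgebraicGeometry.Resolution.BlowupsProperProofs
import Literature.AlgebraicGeometry.Motives.CyclesEquivalencesProofs
import Literature.AlgebraicGeometry.Motives.VarietiesDimensionProofs
import Summits.ResolutionOfSingularities.ResolutionOfSingularities.Theorems.EquisingularLiftEquisingularLiftNatChainIntegral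
import HarnessLib

/-!
# [OURS · L1 W4.5(b) · EL♮] T-DIM — THE LOCAL DIMENSION ALONG A CHAIN OF BLOW-UPS
# (`dim 𝒪_{X′,b} = n + 1` at closed special-fibre points of every stage over `ℙⁿ_O`)

Crux `EquisingularLiftNat` = stmt-ResolutionOfSingularities-20038 (route EquisingularLift), line `sections`; helper file
`--supports … --as helper`. Object T-DIM named by res-D-pv-013 (STATUS 2026-08-27T07:53:28Z (3)): the LOWER bound of the
local dimension of the stages of an item chain, missing next to `IsBlowup.ringKrullDim_stalk_le` (`BlowupDimension.lean`);
consumers: the per-stage `hdim` of the multisection adapter for T-TAIL p508794 / T-Δ-ISO p509522 and res-D-pv-003's L-ADM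
side condition «`n + 1 ≤ dim 𝒪_{X′,ι z}`». HONEST FRAMING: OURS (cell res-hironaka, slot W4.5(b)); NOT a statement of any
manuscript; standard dimension theory. AI-written, weaker than expert review. No `sorry`; standard axioms.

## Content (namespace `…Cruxes.EquisingularLiftNat.Sections`)

* `isUniversallyCatenaryRing_stalk_of_locallyOfFiniteType` — the local rings of a scheme locally of finite type over a
  universally catenary ring `O` are universally catenary (Stacks 00NJ/0ECE; e.g. `O` a DVR:
  `isUniversallyCatenaryRing_of_isDiscreteValuationRing`).
* `ringKrullDim_stalk_eq_of_isBlowup_of_isClosed` — **`dim 𝒪_{X′,x′} = dim 𝒪_{X,π x′}` at every CLOSED point `x′` of a blowing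
  up `π : X′ → X`** of an integral locally Noetherian scheme with `𝒪_{X,π x′}` universally catenary: the residue extension
  `κ(π x′) ⊆ κ(x′)` of a closed point is finite (Stacks 01TB, tree `finite_residueFieldMap_of_isClosed`), so the point is
  residually integral and the tree's dimension formula `IsBlowup.ringKrullDim_stalk_eq_of_residuallyIntegral` (Matsumura
  Thm. 15.6 through the Rees charts) applies.
* `ringKrullDim_stalk_eq_of_chain` — along the item's chain predicate `Split.Chain P Y X′ σ S′` over an integral `P` locally of
  finite type over a universally catenary `O`: `dim 𝒪_{X′,b} = dim 𝒪_{P,σ b}` and `σ b` is closed, for every closed `b ∈ X′`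
  (induction along the chain; blow-ups of locally Noetherian schemes are proper, hence closed and locally of finite type).
* `ringKrullDim_stalk_eq_of_smoothOfRelativeDimension_of_isClosed` — closed points of a scheme smooth of relative dimension
  `n` over a field have `n`-dimensional local rings (Görtz–Wedhorn I Lemma 6.26, tree `height_eq_of_isStandardSmooth…`).
* `ringKrullDim_stalk_eq_succ_of_smoothOfRelativeDimension` — **`dim 𝒪_{P,x} = n + 1`** at a closed point `x` of the special
  fibre of `q : P → Spec O` smooth of relative dimension `n` over a DVR `O` (flat dimension formula EGA IV (6.1.2), tree
  `coheight_eq_coheight_add_ringKrullDim_stalk_fiber`, + the previous item on the fibre + `dim O = 1`).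
* `ringKrullDim_stalk_eq_succ_of_chain` — **T-DIM**: for every stage `(X′, σ, S′)` of an item chain over such a `P` (integral)
  and every closed `b ∈ X′` over the closed point of `O`: `ringKrullDim 𝒪_{X′,b} = n + 1`. For `P = ℙⁿ_O = Proj O[x₀,…,xₙ]`
  with its structure morphism (the item's `q`-spelling) the instance is
  `StrataSplit.smoothOfRelativeDimension_toSpecZero_specMap n O` (Theorems/…ProjectiveAmbientSmoothProper.lean) and
  integrality of `ℙⁿ_O` for a domain `O`; one `haveI` at the call site.

References: Matsumura, *Commutative Ring Theory*, Thms. 15.1, 15.6, 17.9; Stacks 00NJ, 00NM, 01TB, 02NS; EGA IV₂ (6.1.2);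
Görtz–Wedhorn I, Lemma 6.26. Tree: DimensionFormula.lean, PointBlowupHilbertSamuelStrata.lean, CohenMacaulayCatenary.lean,
Motives/CyclesEquivalencesProofs.lean, Motives/VarietiesDimensionProofs.lean, …NatChainIntegral.lean (p-file of res-D-pv-013).
-/

set_option linter.dupNamespace false -- mandated namespace `Summit.<Summit>.<Problem>` of this single-conjunct summit

noncomputable section

open CategoryTheory CategoryTheory.Limits AlgebraicGeometry TopologicalSpace Topology IsLocalRing
open Literature.AlgebraicGeometry.Resolution
open AlgebraicGeometry.Scheme.IdealSheafData
open Summit.ResolutionOfSingularities.ResolutionOfSingularities.Theses.EquisingularLift.Split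

namespace Summit.ResolutionOfSingularities.ResolutionOfSingularities.Cruxes.EquisingularLiftNat.Sections

universe u

/-! ## Universal catenarity of the local rings -/

/-- A discrete valuation ring is universally catenary (it is a regular ring; Stacks 00NM / Matsumura Thm. 17.9, tree
`isUniversallyCatenaryRing_of_isRegularRing'`). [cite: StacksProject, Tag 00NM] -/
theorem isUniversallyCatenaryRing_of_isDiscreteValuationRing (O : Type u) [CommRing O] [IsDomain O]
    [IsDiscreteValuationRing O] : IsUniversallyCatenaryRing O :=
  isUniversallyCatenaryRing_of_isRegularRing' O

/-- **The local rings of a scheme locally of finite type over a universally catenary ring are universally catenary**: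
`𝒪_{X,x}` is a localization of `Γ(X, U)` (`U ∋ x` affine), a finite type `O`-algebra (Stacks 0ECE, 00NJ; tree
`IsUniversallyCatenaryRing.of_finiteType` / `.of_isLocalization`). [cite: StacksProject, Tag 00NJ] -/
theorem isUniversallyCatenaryRing_stalk_of_locallyOfFiniteType {O : Type u} [CommRing O]
    (hO : IsUniversallyCatenaryRing O) {X : Scheme.{u}} (f : X ⟶ Spec (.of O)) [LocallyOfFiniteType f] (x : X) :
    IsUniversallyCatenaryRing (X.presheaf.stalk x) := by
  obtain ⟨U, hU, hxU, -⟩ :=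
    exists_isAffineOpen_mem_and_subset (X := X) (x := x) (U := ⊤) (Opens.mem_top x)
  have hft : RingHom.FiniteType (f.appLE ⊤ U le_top).hom :=
    HasRingHomProperty.appLE @LocallyOfFiniteType f ‹_› ⟨⊤, isAffineOpen_top _⟩ ⟨U, hU⟩ le_top
  let φ : O →+* Γ(X, U) := (f.appLE ⊤ U le_top).hom.comp (Scheme.ΓSpecIso (.of O)).inv.hom
  have hφ : φ.FiniteType :=
    hft.comp (RingHom.FiniteType.of_surjective _
      (Scheme.ΓSpecIso (.of O)).symm.commRingCatIsoToRingEquiv.surjective)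
  letI : Algebra O Γ(X, U) := φ.toAlgebra
  haveI : Algebra.FiniteType O Γ(X, U) := hφ
  have hUC : IsUniversallyCatenaryRing Γ(X, U) := hO.of_finiteType Γ(X, U)
  letI := TopCat.Presheaf.algebra_section_stalk X.presheaf (⟨x, hxU⟩ : (U : X.Opens))
  haveI := hU.isLocalization_stalk ⟨x, hxU⟩
  exact IsUniversallyCatenaryRing.of_isLocalization (B := X.presheaf.stalk x)
    (hU.primeIdealOf ⟨x, hxU⟩).asIdeal.primeCompl hUC

/-! ## One blowing up: the dimension formula at closed points -/

/-- **`dim 𝒪_{X′,x′} = dim 𝒪_{X,π x′}` at a CLOSED point `x′` of a blowing up** `π : X′ → X` (along any ideal sheaf) of an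
integral locally Noetherian scheme whose local ring at `π x′` is universally catenary. A closed point of the source of a
morphism locally of finite type has finite residue extension (Stacks 01TB), hence is residually integral, and the dimension
formula `IsBlowup.ringKrullDim_stalk_eq_of_residuallyIntegral` (Matsumura Thm. 15.6) applies.
[cite: Matsumura1987, Thm. 15.6] [cite: StacksProject, Tag 01TB] -/
theorem ringKrullDim_stalk_eq_of_isBlowup_of_isClosed {X X' : Scheme.{u}} {π : X' ⟶ X} {J : X.IdealSheafData}
    [IsIntegral X] [IsLocallyNoetherian X] (hπ : IsBlowup π J) {x' : X'} (hx' : IsClosed ({x'} : Set X'))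
    (hUC : IsUniversallyCatenaryRing (X.presheaf.stalk (π.base x'))) :
    ringKrullDim (X'.presheaf.stalk x') = ringKrullDim (X.presheaf.stalk (π.base x')) := by
  haveI : IsProper π := hπ.isProper
  refine hπ.ringKrullDim_stalk_eq_of_residuallyIntegral x' hUC fun y => ?_
  have hint : (ResidueField.map (π.stalkMap x').hom).IsIntegral :=
    (finite_residueFieldMap_of_isClosed π hx').to_isIntegral
  obtain ⟨p, hpm, hpy⟩ := hint (residue _ y)
  obtain ⟨P, hPp, -, hPm⟩ := Polynomial.lifts_and_degree_eq_and_monic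
    ((Polynomial.mem_lifts _).mpr (Polynomial.map_surjective _ residue_surjective p)) hpm
  refine ⟨P, hPm, ?_⟩
  rw [← residue_eq_zero_iff, Polynomial.eval_map, Polynomial.hom_eval₂, ← ResidueField.map_comp_residue,
    ← Polynomial.eval₂_map, hPp]
  exact hpy

/-! ## Along an item chain -/

/-- **Along an item chain the local dimension at closed points is that of the ambient**: for `P` integral and locally of
finite type over a universally catenary `O`, every stage `(X′, σ, S′)` of `Split.Chain P Y X′ σ S′` (blow-ups in regular
centres off the generic point `ξ` of `Y`) and every closed `b ∈ X′`: `σ b` is closed in `P` and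
`dim 𝒪_{X′,b} = dim 𝒪_{P,σ b}`. Induction along the chain: the stages are integral (`chain_isIntegral`), locally Noetherian
and locally of finite type over `O`; blow-ups of locally Noetherian schemes are proper (`IsBlowup.isProper`), hence closed
maps, and `ringKrullDim_stalk_eq_of_isBlowup_of_isClosed` applies at the closed point `b` with
`isUniversallyCatenaryRing_stalk_of_locallyOfFiniteType`. [cite: Matsumura1987, Thm. 15.6] -/
theorem ringKrullDim_stalk_eq_of_chain {O : Type} [CommRing O] (hO : IsUniversallyCatenaryRing O) {P : Scheme.{0}}
    [IsIntegral P] (q : P ⟶ Spec (.of O)) [LocallyOfFiniteType q] {Y : Set P} {ξ : P} (hξ : IsGenericPoint ξ Y)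
    {X' : Scheme.{0}} {σ : X' ⟶ P} {S' : Set X'} (h : Chain P Y X' σ S') {b : X'}
    (hb : IsClosed ({b} : Set X')) :
    IsClosed ({σ.base b} : Set P) ∧ ringKrullDim (X'.presheaf.stalk b) = ringKrullDim (P.presheaf.stalk (σ.base b)) := by
  haveI : IsNoetherianRing (CommRingCat.of O) := hO.1
  have key := h (fun X₁ σ₁ S₁ => Chain P Y X₁ σ₁ S₁ ∧ LocallyOfFiniteType σ₁ ∧
      ∀ b : X₁, IsClosed ({b} : Set X₁) →
        IsClosed ({σ₁.base b} : Set P) ∧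
          ringKrullDim (X₁.presheaf.stalk b) = ringKrullDim (P.presheaf.stalk (σ₁.base b))) ?_ ?_
  · exact key.2.2 b hb
  · exact ⟨fun Q h0 _ => h0, inferInstance, fun b hb => ⟨hb, rfl⟩⟩
  · intro X₁ X₂ σ₁ Y₁ C τ hQ hτ hCreg himg
    obtain ⟨hch, hft, hdim⟩ := hQ
    haveI := hft
    haveI : IsIntegral X₁ := chain_isIntegral hξ hch
    haveI : LocallyOfFiniteType (σ₁ ≫ q) := inferInstance
    haveI : IsLocallyNoetherian X₁ := LocallyOfFiniteType.isLocallyNoetherian (σ₁ ≫ q)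
    haveI : IsProper τ := hτ.isProper
    have hch₂ : Chain P Y X₂ (τ ≫ σ₁) (closure (τ ⁻¹' (Y₁ \ (C.support : Set X₁)))) :=
      fun Q h0 hs => hs X₁ X₂ σ₁ Y₁ C τ (hch Q h0 hs) hτ hCreg himg
    refine ⟨hch₂, inferInstance, fun b hb => ?_⟩
    have hτb : IsClosed ({τ.base b} : Set X₁) := by
      simpa only [Set.image_singleton] using τ.isClosedMap _ hb
    obtain ⟨hcl, hd⟩ := hdim (τ.base b) hτb
    refine ⟨by simpa only [Scheme.Hom.comp_base, TopCat.coe_comp, Function.comp_apply] using hcl, ?_⟩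
    rw [show (τ ≫ σ₁).base b = σ₁.base (τ.base b) from by
      simp only [Scheme.Hom.comp_base, TopCat.coe_comp, Function.comp_apply], ← hd]
    exact ringKrullDim_stalk_eq_of_isBlowup_of_isClosed hτ hb
      (isUniversallyCatenaryRing_stalk_of_locallyOfFiniteType hO (σ₁ ≫ q) (τ.base b))

/-! ## The ambient: smooth of relative dimension `n` over a DVR -/

/-- **Closed points of a scheme smooth of relative dimension `n` over a field have `n`-dimensional local rings**
(Görtz–Wedhorn I, Lemma 6.26): `𝒪_{X,x}` is the localization of a standard smooth chart `Γ(X, V)` at the maximal ideal of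
the closed point `x`, of height `n` (tree `height_eq_of_isStandardSmoothOfRelativeDimension`).
[cite: GortzWedhorn2020, Lemma 6.26] -/
theorem ringKrullDim_stalk_eq_of_smoothOfRelativeDimension_of_isClosed {K : Type u} [Field K] {X : Scheme.{u}}
    (f : X ⟶ Spec (.of K)) (n : ℕ) [SmoothOfRelativeDimension n f] {x : X} (hx : IsClosed ({x} : Set X)) :
    ringKrullDim (X.presheaf.stalk x) = n := by
  obtain ⟨V, hV, hxV, φ, hφ⟩ :=
    Literature.AlgebraicGeometry.Motives.exists_isStandardSmoothOfRelativeDimension_of_field f n x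
  algebraize [φ]
  haveI := hV.primeIdealOf_isMaximal_of_isClosed ⟨x, hxV⟩ hx
  have := hV.isLocalization_stalk ⟨x, hxV⟩
  rw [@IsLocalization.AtPrime.ringKrullDim_eq_height _ _ (hV.primeIdealOf ⟨x, hxV⟩).asIdeal _
    (X.presheaf.stalk x) _ (TopCat.Presheaf.algebra_section_stalk X.presheaf ⟨x, hxV⟩) this]
  exact_mod_cast Literature.AlgebraicGeometry.Motives.height_eq_of_isStandardSmoothOfRelativeDimension K n _

/-- **`dim 𝒪_{P,x} = n + 1` at a closed point of the special fibre of a scheme smooth of relative dimension `n` over a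
DVR.** By the flat dimension formula (EGA IV₂ (6.1.2), tree `coheight_eq_coheight_add_ringKrullDim_stalk_fiber`)
`codim x = codim s₀ + dim 𝒪_{P_{s₀},x}`; `codim s₀ = dim O = 1`, and the fibre `P_{s₀}` is smooth of relative dimension `n`
over `κ(s₀)` with `x` closed in it, so its local ring at `x` has dimension `n`.
[cite: GrothendieckDieudonne1965, Cor. (6.1.2), p. 135] [cite: GortzWedhorn2020, Lemma 6.26] -/
theorem ringKrullDim_stalk_eq_succ_of_smoothOfRelativeDimension {O : Type} [CommRing O] [IsDomain O]
    [IsDiscreteValuationRing O] {P : Scheme.{0}} (q : P ⟶ Spec (.of O)) (n : ℕ) [SmoothOfRelativeDimension n q]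
    {x : P} (hx : IsClosed ({x} : Set P)) (hxs : q.base x = closedPoint O) :
    ringKrullDim (P.presheaf.stalk x) = (n + 1 : ℕ) := by
  haveI : Smooth q := SmoothOfRelativeDimension.smooth n q
  haveI : IsNoetherianRing (CommRingCat.of O) := inferInstanceAs (IsNoetherianRing O)
  haveI : IsLocallyNoetherian P := LocallyOfFiniteType.isLocallyNoetherian q
  have hform := Literature.AlgebraicGeometry.Motives.coheight_eq_coheight_add_ringKrullDim_stalk_fiber q x
  -- `codim s₀ = 1`
  have h1 : (Order.coheight (q.base x) : WithBot ℕ∞) = 1 := by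
    rw [← ringKrullDim_stalk_eq_coheight, hxs,
      ringKrullDim_eq_of_ringEquiv (stalkClosedPointIso (.of O)).commRingCatIsoToRingEquiv]
    exact IsDiscreteValuationRing.ringKrullDim_eq_one O
  -- the fibre is smooth of relative dimension `n` over `κ(s₀)` and `x` is closed in it
  haveI := smoothOfRelativeDimension_isStableUnderBaseChange (n := n)
  haveI : SmoothOfRelativeDimension n (q.fiberToSpecResidueField (q.base x)) :=
    MorphismProperty.pullback_snd (P := @SmoothOfRelativeDimension n) _ _ ‹SmoothOfRelativeDimension n q›
  have hxf : IsClosed ({q.asFiber x} : Set ↥(q.fiber (q.base x))) := by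
    have hc : IsClosed ({⟨x, rfl⟩} : Set (q.base ⁻¹' {q.base x})) := by
      convert hx.preimage continuous_subtype_val using 1
      ext ⟨z, hz⟩
      simp only [Set.mem_singleton_iff, Set.mem_preimage, Subtype.mk.injEq]
    have := hc.preimage (q.fiberHomeo (q.base x)).continuous
    convert this using 1
    ext z
    simp only [Set.mem_singleton_iff, Set.mem_preimage]
    constructor
    · rintro rfl; exact (q.fiberHomeo (q.base x)).apply_symm_apply _
    · intro hz
      rw [Scheme.Hom.asFiber, ← hz, Homeomorph.symm_apply_apply]
  have h2 := @ringKrullDim_stalk_eq_of_smoothOfRelativeDimension_of_isClosed _ _ _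
    (q.fiberToSpecResidueField (q.base x)) n ‹_› _ hxf
  rw [ringKrullDim_stalk_eq_coheight, hform, h1, h2]
  norm_cast
  simp [add_comm]

/-! ## T-DIM -/

/-- **T-DIM.** Let `O` be a DVR, `q : P → Spec O` smooth of relative dimension `n` with `P` integral, `Y ⊆ P` with generic
point `ξ`, and `(X′, σ, S′)` a stage of the item chain `Split.Chain P Y X′ σ S′`. Then at every CLOSED point `b ∈ X′` lying over
the closed point of `O`, **`dim 𝒪_{X′,b} = n + 1`**. [cite: Matsumura1987, Thm. 15.6] -/
theorem ringKrullDim_stalk_eq_succ_of_chain {O : Type} [CommRing O] [IsDomain O] [IsDiscreteValuationRing O]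
    {P : Scheme.{0}} [IsIntegral P] (q : P ⟶ Spec (.of O)) (n : ℕ) [SmoothOfRelativeDimension n q]
    {Y : Set P} {ξ : P} (hξ : IsGenericPoint ξ Y) {X' : Scheme.{0}} {σ : X' ⟶ P} {S' : Set X'}
    (h : Chain P Y X' σ S') {b : X'} (hb : IsClosed ({b} : Set X')) (hbs : (σ ≫ q).base b = closedPoint O) :
    ringKrullDim (X'.presheaf.stalk b) = (n + 1 : ℕ) := by
  haveI : Smooth q := SmoothOfRelativeDimension.smooth n q
  obtain ⟨hcl, hd⟩ := ringKrullDim_stalk_eq_of_chain (isUniversallyCatenaryRing_of_isDiscreteValuationRing O) q hξ h hb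
  rw [hd]
  refine ringKrullDim_stalk_eq_succ_of_smoothOfRelativeDimension q n hcl ?_
  simpa only [Scheme.Hom.comp_base, TopCat.coe_comp, Function.comp_apply] using hbs

end Summit.ResolutionOfSingularities.ResolutionOfSingularities.Cruxes.EquisingularLiftNat.Sections

end
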